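import Mathlib
import HarnessLib

/-!
# The weighted power sums `∑_{r<q} (1 - r/q) r^s ≤ q^{1+s}/((1+s)(2+s))` for `s = 1, 1/2, -1/2`

Topic `Literature/NumberTheory/LFunctions`. The inequality
`∑_{r=1}^{q} (1 - r/q) r^s ≤ q^{1+s}/((1+s)(2+s))` (`-1 < s ≤ 1`, `q ≥ 1` an integer) is the
display used in the proof of Lemma 2.4 of A. Yang, *Explicit bounds on `ζ(s)` in the critical
strip and a zero-free region*, J. Math. Anal. Appl. 534 (2024) = arXiv:2301.03165 (credited there
to Patel 2022, (32), and Hiary 2016, (45)), and eq. (3.21) of Patel–Yang, J. Number Theory 262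
(2024). The explicit third-derivative test (Yang, Lemma 2.4) uses it for `s = 1/2, 1, -1/2`;
these three cases are PROVED here, by comparing the sum with the integral
`∫_0^q (1 - x/q) x^s dx` through elementary termwise inequalities (trapezoid steps for the concave
integrands `x - x²/q`, `x^{1/2} - x^{3/2}/q`, a left-endpoint step for the decreasing integrand
`x^{-1/2} - x^{1/2}/q`), which reduce to polynomial inequalities in `√r`, `√(r-1)`.

## Main results

* `Literature.NumberTheory.LFunctions.VdC.dhir_one` — `∑_{r<q} (1 - r/q) r ≤ q²/6`.
* `Literature.NumberTheory.LFunctions.VdC.dhir_half` — `∑_{r<q} (1 - r/q) √r ≤ (4/15) q √q`.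
* `Literature.NumberTheory.LFunctions.VdC.dhir_neg_half` — `∑_{r<q} (1 - r/q)/√r ≤ (4/3) √q`.

## References

* A. Yang, op. cit., proof of Lemma 2.4. [cite: Yang2024, Lemma 2.4 (proof)]
* D. Patel, A. Yang, *An explicit sub-Weyl bound for `ζ(1/2 + it)`*, J. Number Theory 262
  (2024), eq. (3.21). [cite: PatelYang2024, (3.21)]
-/

noncomputable section

open Finset Real

namespace Literature.NumberTheory.LFunctions
namespace VdC

/-! ### Two summation templates -/

/-- `∑_{r<q} φ(r+1) = ∑_{1 ≤ r < q} φ(r)` when `φ(q) = 0` (`q ≥ 1`). [folklore] -/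
theorem sum_range_succ_eq_sum_Ico (φ : ℕ → ℝ) {q : ℕ} (hqpos : 0 < q) (hq : φ q = 0) :
    ∑ r ∈ Finset.range q, φ (r + 1) = ∑ r ∈ Finset.Ico 1 q, φ r := by
  have h1 : ∑ r ∈ Finset.Ico 1 (q + 1), φ r = ∑ r ∈ Finset.range q, φ (r + 1) := by
    rw [Finset.sum_Ico_eq_sum_range, Nat.add_sub_cancel]
    exact Finset.sum_congr rfl fun r _ => by rw [add_comm]
  rw [← h1, Finset.sum_Ico_succ_top hqpos, hq, add_zero]

/-- **Trapezoid template.** If `φ(0) = φ(q) = 0` and `(φ(r-1) + φ(r))/2 ≤ Φ(r) - Φ(r-1)` for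
`1 ≤ r ≤ q`, then `∑_{r=1}^{q-1} φ(r) ≤ Φ(q) - Φ(0)`. [folklore] -/
theorem sum_Ico_le_of_trapezoid (φ Φ : ℕ → ℝ) (q : ℕ) (h0 : φ 0 = 0) (hq : φ q = 0)
    (hstep : ∀ r, 1 ≤ r → r ≤ q → (φ (r - 1) + φ r) / 2 ≤ Φ r - Φ (r - 1)) :
    ∑ r ∈ Finset.Ico 1 q, φ r ≤ Φ q - Φ 0 := by
  have htel : ∑ r ∈ Finset.range q, (Φ (r + 1) - Φ r) = Φ q - Φ 0 := Finset.sum_range_sub Φ q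
  rcases Nat.eq_zero_or_pos q with rfl | hqpos
  · simp
  have hsum : ∑ r ∈ Finset.range q, (φ r + φ (r + 1)) / 2 = ∑ r ∈ Finset.Ico 1 q, φ r := by
    have h1 : ∑ r ∈ Finset.range q, (φ r + φ (r + 1)) / 2
        = ((∑ r ∈ Finset.range q, φ r) + ∑ r ∈ Finset.range q, φ (r + 1)) / 2 := by
      rw [← Finset.sum_add_distrib, Finset.sum_div]
    have h2 : ∑ r ∈ Finset.range q, φ r = ∑ r ∈ Finset.Ico 1 q, φ r := by
      rw [Finset.range_eq_Ico, Finset.sum_eq_sum_Ico_succ_bot hqpos, h0, zero_add]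
    rw [h1, h2, sum_range_succ_eq_sum_Ico φ hqpos hq]
    ring
  rw [← hsum, ← htel]
  refine Finset.sum_le_sum fun r hr => ?_
  have := hstep (r + 1) (by omega) (by rw [Finset.mem_range] at hr; omega)
  simpa using this

/-- **Left-endpoint template.** If `ψ(q) = 0` and `ψ(r) ≤ Ψ(r) - Ψ(r-1)` for `1 ≤ r ≤ q`, then
`∑_{r=1}^{q-1} ψ(r) ≤ Ψ(q) - Ψ(0)`. [folklore] -/
theorem sum_Ico_le_of_left (ψ Ψ : ℕ → ℝ) (q : ℕ) (hq : ψ q = 0)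
    (hstep : ∀ r, 1 ≤ r → r ≤ q → ψ r ≤ Ψ r - Ψ (r - 1)) :
    ∑ r ∈ Finset.Ico 1 q, ψ r ≤ Ψ q - Ψ 0 := by
  have htel : ∑ r ∈ Finset.range q, (Ψ (r + 1) - Ψ r) = Ψ q - Ψ 0 := Finset.sum_range_sub Ψ q
  rcases Nat.eq_zero_or_pos q with rfl | hqpos
  · simp
  rw [← sum_range_succ_eq_sum_Ico ψ hqpos hq, ← htel]
  refine Finset.sum_le_sum fun r hr => ?_
  have := hstep (r + 1) (by omega) (by rw [Finset.mem_range] at hr; omega)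
  simpa using this

/-! ### `s = 1` -/

/-- `∑_{r=1}^{q-1} (1 - r/q) r ≤ q²/6` (indeed `= (q² - 1)/6`). [cite: Yang2024, Lemma 2.4 (proof)] -/
theorem dhir_one (q : ℕ) (hq : 1 ≤ q) :
    ∑ r ∈ Finset.Ico 1 q, (1 - (r : ℝ) / q) * r ≤ (q : ℝ) ^ 2 / 6 := by
  have hqpos : (0 : ℝ) < q := by exact_mod_cast hq
  set φ : ℕ → ℝ := fun r => (1 - (r : ℝ) / q) * r with hφ
  set Φ : ℕ → ℝ := fun r => (r : ℝ) ^ 2 / 2 - (r : ℝ) ^ 3 / (3 * q) with hΦ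
  have hφq : φ q = 0 := by simp only [hφ]; rw [div_self hqpos.ne']; ring
  have h := sum_Ico_le_of_trapezoid φ Φ q (by simp [hφ]) hφq ?_
  · have e : Φ q - Φ 0 = (q : ℝ) ^ 2 / 6 := by
      simp only [hΦ, Nat.cast_zero]
      field_simp; ring
    linarith
  · intro r hr1 _
    have hr : ((r - 1 : ℕ) : ℝ) = (r : ℝ) - 1 := by rw [Nat.cast_sub hr1]; simp
    simp only [hφ, hΦ, hr]
    rw [div_le_iff₀ (by norm_num : (0:ℝ) < 2)]
    -- the gap is exactly `1/(3q)` (doubled)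
    have e : ((r : ℝ) ^ 2 / 2 - (r : ℝ) ^ 3 / (3 * q) - (((r : ℝ) - 1) ^ 2 / 2 - ((r : ℝ) - 1) ^ 3 / (3 * q))) * 2
        - ((1 - ((r : ℝ) - 1) / q) * ((r : ℝ) - 1) + (1 - (r : ℝ) / q) * r) = 1 / (3 * q) := by
      field_simp; ring
    have hpos : 0 ≤ 1 / (3 * (q : ℝ)) := by positivity
    linarith

/-! ### `s = 1/2` -/

/-- The trapezoid step for `x^{1/2} - x^{3/2}/q` on `[r-1, r]`, as an inequality in `a = √r`,
`b = √(r-1)` (`a² = b² + 1`): `q((a+b)/2 - (2/3)(a³-b³)) ≤ (a³+b³)/2 - (2/5)(a⁵-b⁵)`, the left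
side being `≤ 0 ≤` the right side. [folklore] -/
theorem trapezoid_step_half {a b q : ℝ} (ha : 0 ≤ a) (hb : 0 ≤ b) (hab : a ^ 2 = b ^ 2 + 1)
    (hq : 0 ≤ q) :
    q * ((a + b) / 2 - 2 / 3 * (a ^ 3 - b ^ 3)) ≤ (a ^ 3 + b ^ 3) / 2 - 2 / 5 * (a ^ 5 - b ^ 5) := by
  have hba : b ≤ a := by nlinarith
  have hab' : (a - b) * (a + b) = 1 := by nlinarith
  have hsum : 0 < a + b := by nlinarith
  -- left factor ≤ 0: `3(a+b)² ≤ 4(a²+ab+b²)`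
  have hcoef : (a + b) / 2 - 2 / 3 * (a ^ 3 - b ^ 3) ≤ 0 := by
    have key : ((a + b) / 2 - 2 / 3 * (a ^ 3 - b ^ 3)) * (a + b)
        = (a + b) ^ 2 / 2 - 2 / 3 * (a ^ 2 + a * b + b ^ 2) := by
      linear_combination (-(2 / 3) * (a ^ 2 + a * b + b ^ 2)) * hab'
    have hneg : (a + b) ^ 2 / 2 - 2 / 3 * (a ^ 2 + a * b + b ^ 2) ≤ 0 := by
      nlinarith [sq_nonneg (a - b)]
    exact le_of_mul_le_mul_right (by rw [key, zero_mul]; exact hneg) hsum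
  -- right side ≥ 0: `5(a³+b³)(a+b) - 4(a⁴+a³b+a²b²+ab³+b⁴) = (a-b)²(a²+3ab+b²)`
  have hrhs : 0 ≤ (a ^ 3 + b ^ 3) / 2 - 2 / 5 * (a ^ 5 - b ^ 5) := by
    have key : ((a ^ 3 + b ^ 3) / 2 - 2 / 5 * (a ^ 5 - b ^ 5)) * (a + b)
        = (a ^ 3 + b ^ 3) * (a + b) / 2
          - 2 / 5 * (a ^ 4 + a ^ 3 * b + a ^ 2 * b ^ 2 + a * b ^ 3 + b ^ 4) := by
      linear_combination (-(2 / 5) * (a ^ 4 + a ^ 3 * b + a ^ 2 * b ^ 2 + a * b ^ 3 + b ^ 4)) * hab'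
    have hpos : 0 ≤ (a ^ 3 + b ^ 3) * (a + b) / 2
        - 2 / 5 * (a ^ 4 + a ^ 3 * b + a ^ 2 * b ^ 2 + a * b ^ 3 + b ^ 4) := by
      have : (a ^ 3 + b ^ 3) * (a + b) / 2 - 2 / 5 * (a ^ 4 + a ^ 3 * b + a ^ 2 * b ^ 2 + a * b ^ 3 + b ^ 4)
          = (a - b) ^ 2 * (a ^ 2 + 3 * a * b + b ^ 2) / 10 := by ring
      rw [this]; positivity
    exact le_of_mul_le_mul_right (by rw [zero_mul, key]; exact hpos) hsum
  calc q * ((a + b) / 2 - 2 / 3 * (a ^ 3 - b ^ 3)) ≤ 0 := mul_nonpos_of_nonneg_of_nonpos hq hcoef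
    _ ≤ _ := hrhs

/-- `∑_{r=1}^{q-1} (1 - r/q) √r ≤ (4/15) q √q`. [cite: Yang2024, Lemma 2.4 (proof)] -/
theorem dhir_half (q : ℕ) (hq : 1 ≤ q) :
    ∑ r ∈ Finset.Ico 1 q, (1 - (r : ℝ) / q) * Real.sqrt r ≤ 4 / 15 * (q : ℝ) * Real.sqrt q := by
  have hqpos : (0 : ℝ) < q := by exact_mod_cast hq
  set φ : ℕ → ℝ := fun r => (1 - (r : ℝ) / q) * Real.sqrt r with hφ
  set Φ : ℕ → ℝ := fun r => 2 / 3 * (r : ℝ) * Real.sqrt r - 2 / 5 * (r : ℝ) ^ 2 * Real.sqrt r / q with hΦ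
  have hφq : φ q = 0 := by simp only [hφ]; rw [div_self hqpos.ne']; ring
  have h := sum_Ico_le_of_trapezoid φ Φ q (by simp [hφ]) hφq ?_
  · have e : Φ q - Φ 0 = 4 / 15 * (q : ℝ) * Real.sqrt q := by
      simp only [hΦ, Nat.cast_zero, Real.sqrt_zero, mul_zero, zero_div, sub_zero]
      field_simp
      ring
    linarith
  · intro r hr1 hrq
    set a : ℝ := Real.sqrt r with ha
    set b : ℝ := Real.sqrt ((r - 1 : ℕ) : ℝ) with hb
    have hr : ((r - 1 : ℕ) : ℝ) = (r : ℝ) - 1 := by rw [Nat.cast_sub hr1]; simp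
    have hr0 : (0 : ℝ) ≤ (r : ℝ) - 1 := by
      have : (1 : ℝ) ≤ r := by exact_mod_cast hr1
      linarith
    have ha2 : a ^ 2 = r := Real.sq_sqrt (Nat.cast_nonneg r)
    have hb2 : b ^ 2 = (r : ℝ) - 1 := by rw [hb, hr]; exact Real.sq_sqrt hr0
    have ha0 : 0 ≤ a := Real.sqrt_nonneg _
    have hb0 : 0 ≤ b := Real.sqrt_nonneg _
    have hab : a ^ 2 = b ^ 2 + 1 := by rw [ha2, hb2]; ring
    -- express everything through `a`, `b`
    have eφr : φ r = a - a ^ 3 / q := by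
      simp only [hφ]; rw [← ha, ← ha2]; ring
    have eφr1 : φ (r - 1) = b - b ^ 3 / q := by
      simp only [hφ]; rw [← hb, hr, ← hb2]; ring
    have eΦr : Φ r = 2 / 3 * a ^ 3 - 2 / 5 * a ^ 5 / q := by
      simp only [hΦ]; rw [← ha, ← ha2]; ring
    have eΦr1 : Φ (r - 1) = 2 / 3 * b ^ 3 - 2 / 5 * b ^ 5 / q := by
      simp only [hΦ]; rw [← hb, hr, ← hb2]; ring
    rw [eφr, eφr1, eΦr, eΦr1]
    have key := trapezoid_step_half ha0 hb0 hab hqpos.le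
    rw [← mul_le_mul_iff_of_pos_left hqpos]
    have e1 : (q : ℝ) * ((b - b ^ 3 / q + (a - a ^ 3 / q)) / 2) = (q * (a + b) - (a ^ 3 + b ^ 3)) / 2 := by
      field_simp
      ring
    have e2 : (q : ℝ) * (2 / 3 * a ^ 3 - 2 / 5 * a ^ 5 / q - (2 / 3 * b ^ 3 - 2 / 5 * b ^ 5 / q))
        = 2 / 3 * (a ^ 3 - b ^ 3) * q - 2 / 5 * (a ^ 5 - b ^ 5) := by
      field_simp
      ring
    rw [e1, e2]
    linarith

/-! ### `s = -1/2` -/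

/-- The left-endpoint step for `x^{-1/2} - x^{1/2}/q` on `[r-1, r]` (`a = √r > 0`, `b = √(r-1)`):
`q(1/a - 2(a - b)) ≤ a - (2/3)(a³ - b³)`. [folklore] -/
theorem left_step_neg_half {a b q : ℝ} (ha : 0 < a) (hb : 0 ≤ b) (hab : a ^ 2 = b ^ 2 + 1)
    (hq : 0 ≤ q) : q * (1 / a - 2 * (a - b)) ≤ a - 2 / 3 * (a ^ 3 - b ^ 3) := by
  have hba : b ≤ a := by nlinarith
  have hab' : (a - b) * (a + b) = 1 := by nlinarith
  have hsum : 0 < a + b := by linarith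
  have hcoef : 1 / a - 2 * (a - b) ≤ 0 := by
    have e : a - b = 1 / (a + b) := by field_simp; linarith
    have h1 : 1 / a ≤ 2 / (a + b) := by
      rw [div_le_div_iff₀ ha hsum]; linarith
    have h2 : 2 / (a + b) = 2 * (a - b) := by rw [e]; ring
    linarith
  have hrhs : 0 ≤ a - 2 / 3 * (a ^ 3 - b ^ 3) := by
    have key : (a - 2 / 3 * (a ^ 3 - b ^ 3)) * (a + b) = a * (a + b) - 2 / 3 * (a ^ 2 + a * b + b ^ 2) := by
      linear_combination (-(2 / 3) * (a ^ 2 + a * b + b ^ 2)) * hab'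
    have hpos : 0 ≤ a * (a + b) - 2 / 3 * (a ^ 2 + a * b + b ^ 2) := by
      have : a * (a + b) - 2 / 3 * (a ^ 2 + a * b + b ^ 2) = (a - b) * (a + 2 * b) / 3 := by ring
      rw [this]; exact div_nonneg (mul_nonneg (by linarith) (by linarith)) (by norm_num)
    exact le_of_mul_le_mul_right (by rw [zero_mul, key]; exact hpos) hsum
  calc q * (1 / a - 2 * (a - b)) ≤ 0 := mul_nonpos_of_nonneg_of_nonpos hq hcoef
    _ ≤ _ := hrhs

/-- `∑_{r=1}^{q-1} (1 - r/q)/√r ≤ (4/3) √q`. [cite: Yang2024, Lemma 2.4 (proof)] -/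
theorem dhir_neg_half (q : ℕ) (hq : 1 ≤ q) :
    ∑ r ∈ Finset.Ico 1 q, (1 - (r : ℝ) / q) / Real.sqrt r ≤ 4 / 3 * Real.sqrt q := by
  have hqpos : (0 : ℝ) < q := by exact_mod_cast hq
  set ψ : ℕ → ℝ := fun r => (1 - (r : ℝ) / q) / Real.sqrt r with hψ
  set Ψ : ℕ → ℝ := fun r => 2 * Real.sqrt r - 2 / 3 * (r : ℝ) * Real.sqrt r / q with hΨ
  have hψq : ψ q = 0 := by simp only [hψ]; rw [div_self hqpos.ne']; ring
  have h := sum_Ico_le_of_left ψ Ψ q hψq ?_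
  · have e : Ψ q - Ψ 0 = 4 / 3 * Real.sqrt q := by
      simp only [hΨ, Nat.cast_zero, Real.sqrt_zero, mul_zero, zero_div, sub_zero]
      field_simp
      ring
    linarith
  · intro r hr1 hrq
    set a : ℝ := Real.sqrt r with ha
    set b : ℝ := Real.sqrt ((r - 1 : ℕ) : ℝ) with hb
    have hr : ((r - 1 : ℕ) : ℝ) = (r : ℝ) - 1 := by rw [Nat.cast_sub hr1]; simp
    have hr0 : (0 : ℝ) ≤ (r : ℝ) - 1 := by
      have : (1 : ℝ) ≤ r := by exact_mod_cast hr1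
      linarith
    have hrpos : (0 : ℝ) < r := by exact_mod_cast hr1
    have ha2 : a ^ 2 = r := Real.sq_sqrt (Nat.cast_nonneg r)
    have hb2 : b ^ 2 = (r : ℝ) - 1 := by rw [hb, hr]; exact Real.sq_sqrt hr0
    have hb0 : 0 ≤ b := Real.sqrt_nonneg _
    have hapos : 0 < a := Real.sqrt_pos.2 hrpos
    have hab : a ^ 2 = b ^ 2 + 1 := by rw [ha2, hb2]; ring
    have eψ : ψ r = 1 / a - a / q := by
      simp only [hψ]; rw [← ha, ← ha2]; field_simp
    have eΨr : Ψ r = 2 * a - 2 / 3 * a ^ 3 / q := by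
      simp only [hΨ]; rw [← ha, ← ha2]; ring
    have eΨr1 : Ψ (r - 1) = 2 * b - 2 / 3 * b ^ 3 / q := by
      simp only [hΨ]; rw [← hb, hr, ← hb2]; ring
    rw [eψ, eΨr, eΨr1]
    have key := left_step_neg_half hapos hb0 hab hqpos.le
    rw [← mul_le_mul_iff_of_pos_left hqpos]
    have e1 : (q : ℝ) * (1 / a - a / q) = q * (1 / a) - a := by
      field_simp
    have e2 : (q : ℝ) * (2 * a - 2 / 3 * a ^ 3 / q - (2 * b - 2 / 3 * b ^ 3 / q))
        = 2 * (a - b) * q - 2 / 3 * (a ^ 3 - b ^ 3) := by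
      field_simp
      ring
    rw [e1, e2]
    nlinarith [key]

end VdC
end Literature.NumberTheory.LFunctions
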